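import Mathlib
import Summits.Ventures.HodgeRepro.Tier4.Line4.SeesawDistribution
import Summits.Ventures.HodgeRepro.Tier4.Line4.TorusArchClosed
import Summits.Ventures.HodgeRepro.Tier4.Line4.WeightCharacter

/-!
# Tier4/Line4/WeightCharacterSeesaw — the wall's `_hchi` BY CONSTRUCTION on the SEESAW PLANE
`(mixedRow q (a 0) (a 2)).withTransportedTorus g g' …` (= LINE L4's `seesawPlane`), the torus `T` (C-L4-B-EXTEND,
part 3a; the torus `T′` is part 3b, `WeightCharacterSeesawPrime.lean`, which imports this module)

Blind re-derivation cell `pub-hodge-repro`, Tier 4 «prove the step» (README §9–§10), seat t4-x2 (reserve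
wall-breaker, gen 6; GO S16576).  Tree path `lean/Summits/Ventures/HodgeRepro/Tier4/Line4/WeightCharacterSeesaw.lean`.
Imports: Mathlib + Common (`RowWeights` / `RowTorus` / `TorusInfCompact` through `WeightCharacter`) + Line4
(`SeesawDistribution`: `isGenuineRow_seesawPlane`; `TorusArchClosed` (L4-p2, p723452):
`eq_one_of_mem_rationalPoints_of_mem_infinitePart`; `WeightCharacter`: `weightAt_eq_one_of_mem_atPlace_ne`,
`mem_infinitePart_of_mem_atPlace`; `CharacterExtend`: the generic extension and its `ℂ`-valued torus form).  No
definition, no instance, no printed theorem proved.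

WHAT.  The wall `mixed_two_torus` quantifies over `R : RTFData (seesawPlane …)` with `_hchi : ∀ w, ChiMatchesAt … (eP w)
(eM w) R.chi`, `_hchi' : ∀ w, ChiMatchesAt' … g g' (eP' w) (eM' w) R.chi'`, `hc hu hc' _hunit'` (continuity and
unitarity) and the five `RTFData` character fields.  Here, on the seesaw plane itself:
* the `T`-side weights of the seesaw plane are those of the row plane `mixedRow q (a 0) (a 2)` (the transport does not
  touch `B`, `Ω`, `P`): `weightAt_mul_seesaw`, `norm_weightAt_eq_one_seesaw` (RowWeights read on the seesaw plane, the
  transport pattern of L4-p1's KTypeOfPeriodTransported), the weight monomials `weight_monomial_mul_seesaw`,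
  `norm_weight_monomial_seesaw`, `continuous_weight_monomial_seesaw`, the character `exists_weight_character_seesaw`,
  the local reading `prod_weight_monomial_of_mem_localTorusAt` (any plane), and
  **`exists_wall_character_ktypes_seesaw`** — the wall's `chi`, `chi_mul`, `chi_rational`, `hc`, `hu`, `_hchi` for `T`;
* `rationalOf_inf_torusInf'_eq_bot`, `isClosed_rationalOf_torusT'` — the `T′` twins of L4-p2's two consumer
  obligations (any plane; the same three-line proofs), consumed by part 3b (`WeightCharacterSeesawPrime.lean`: the `T′`
  character `chi'` with `_hchi'`).
Hypotheses of the seesaw plane exactly as in the wall: `q.t = 0`, `¬ IsSquare (−q.n)` (for `IsGenuineRow`), `a i ≠ 0`,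
the transport `g g' hgg' hg'g hgΩ`, the similitude `lam hlam hiso`, `hreal`, `hcm`, `hA : IsAnisotropic`.  NOT here: the
PAIR `(chi, chi')` with the centre condition `chi_centre` (N2) — the two characters are extended INDEPENDENTLY here;
their agreement on `Z(𝔸)` needs the joint extension (consistency on `Z_∞`: `eP w + eM w = eP' w + eM' w`, the line's
dictionary) — and the face's identity.  Nothing here says anything about the status of the Hodge conjecture for CM
abelian varieties, which is NOT proved; HC_CM is NOT proved by anyone in this repository.
-/

set_option autoImplicit false

noncomputable section

namespace Summit.Ventures.HodgeRepro.Tier4.Line4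

open NumberField Matrix Summit.Ventures.HodgeRepro.Tier4.Common Summit.Ventures.HodgeRepro.Tier4.Line1
  Summit.Ventures.HodgeRepro.Tier4.Lit

section AnyPlane

variable {k : Type} [Field k] [NumberField k] (W : PlaneData k) (q : QuadData k)

/-- **On the local torus at `w` only the `w`-factor of the weight monomials survives** (any plane; WeightCharacter's
`weight_character_apply_of_mem_localTorusAt` without the row-plane spelling). -/
theorem prod_weight_monomial_of_mem_localTorusAt (eP eM : InfinitePlace k → ℤ) (w : InfinitePlace k) {κ : GA W}
    (hκ : κ ∈ localTorusAt W w) :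
    (∏ w' : InfinitePlace k, (weightAt W q w' 0 κ ^ (-(eP w')) * weightAt W q w' 1 κ ^ (-(eM w')))) =
      weightAt W q w 0 κ ^ (-(eP w)) * weightAt W q w 1 κ ^ (-(eM w)) := by
  rw [Finset.prod_eq_single w]
  · intro w' _ hne
    rw [weightAt_eq_one_of_mem_atPlace_ne W q hne hκ.2 0, weightAt_eq_one_of_mem_atPlace_ne W q hne hκ.2 1,
      _root_.one_zpow, _root_.one_zpow, mul_one]
  · intro h
    exact absurd (Finset.mem_univ w) h

/-- **`T′(k) ∩ T′_∞ = 1`** (the `T′` twin of L4-p2's `rationalOf_inf_torusInf_eq_bot`, same proof). -/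
theorem rationalOf_inf_torusInf'_eq_bot : rationalOf W (torusT' W) ⊓ torusInf' W = ⊥ := by
  rw [Subgroup.eq_bot_iff_forall]
  intro t ht
  obtain ⟨hr, hi⟩ := Subgroup.mem_inf.1 ht
  rw [rationalOf, Subgroup.mem_subgroupOf] at hr
  rw [torusInf', Subgroup.mem_subgroupOf] at hi
  exact Subtype.ext (eq_one_of_mem_rationalPoints_of_mem_infinitePart W hr hi)

/-- `T′(k)` is closed in `T′(𝔸)` (the `T′` twin of L4-p2's `isClosed_rationalOf_torusT`, same proof). -/
theorem isClosed_rationalOf_torusT' :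
    IsClosed ((rationalOf W (torusT' W) : Subgroup (torusT' W)) : Set (torusT' W)) := by
  have h : ((rationalOf W (torusT' W) : Subgroup (torusT' W)) : Set (torusT' W)) =
      Subtype.val ⁻¹' ((rationalPoints W : Subgroup (GA W)) : Set (GA W)) := by
    ext t
    simp only [Set.mem_preimage, SetLike.mem_coe, rationalOf, Subgroup.mem_subgroupOf]
  rw [h]
  exact (rationalPoints_closed W).preimage continuous_subtype_val

end AnyPlane

section Seesaw

variable {k : Type} [Field k] [NumberField k] (q : QuadData k) (a : Fin 4 → k)
  (g g' : Matrix (Fin 4) (Fin 4) k) (hgg' : g * g' = 1) (hg'g : g' * g = 1)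
  (hgΩ : g * (PlaneData.mixedRow q (a 0) (a 2)).Ω = (PlaneData.mixedRow q (a 0) (a 2)).Ω * g)

/-! ### The torus `T` of the seesaw plane: the row-plane weights, read on the seesaw plane -/

/-- `weightAt … j` is multiplicative on `T(𝔸)` of the seesaw plane (RowWeights `weightAt_mul` read on the seesaw
plane: `B`, `Ω`, `P` are those of `mixedRow q (a 0) (a 2) = ofLinesRow q (a 0) (a 2) (-1)`). -/
theorem weightAt_mul_seesaw (ha0 : a 0 ≠ 0) (ha2 : a 2 ≠ 0) (w : InfinitePlace k) (hw : w.IsReal) (hcm : IsCMAt q w)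
    (j : Fin 2) {κ κ' : GA ((PlaneData.mixedRow q (a 0) (a 2)).withTransportedTorus g g' hgg' hg'g hgΩ)}
    (hκ : κ ∈ torusT ((PlaneData.mixedRow q (a 0) (a 2)).withTransportedTorus g g' hgg' hg'g hgΩ))
    (hκ' : κ' ∈ torusT ((PlaneData.mixedRow q (a 0) (a 2)).withTransportedTorus g g' hgg' hg'g hgΩ)) :
    weightAt ((PlaneData.mixedRow q (a 0) (a 2)).withTransportedTorus g g' hgg' hg'g hgΩ) q w j (κ * κ') =
      weightAt ((PlaneData.mixedRow q (a 0) (a 2)).withTransportedTorus g g' hgg' hg'g hgΩ) q w j κ *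
        weightAt ((PlaneData.mixedRow q (a 0) (a 2)).withTransportedTorus g g' hgg' hg'g hgΩ) q w j κ' :=
  weightAt_mul q (a 0) (a 2) (-1) w ha0 ha2 (neg_ne_zero.2 one_ne_zero) hw hcm j hκ hκ'

/-- `‖weightAt … j κ‖ = 1` on `T(𝔸)` of the seesaw plane (RowWeights `norm_weightAt_eq_one` read on the seesaw plane). -/
theorem norm_weightAt_eq_one_seesaw (ha0 : a 0 ≠ 0) (ha2 : a 2 ≠ 0) (w : InfinitePlace k) (hw : w.IsReal)
    (hcm : IsCMAt q w) (j : Fin 2) {κ : GA ((PlaneData.mixedRow q (a 0) (a 2)).withTransportedTorus g g' hgg' hg'g hgΩ)}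
    (hκ : κ ∈ torusT ((PlaneData.mixedRow q (a 0) (a 2)).withTransportedTorus g g' hgg' hg'g hgΩ)) :
    ‖weightAt ((PlaneData.mixedRow q (a 0) (a 2)).withTransportedTorus g g' hgg' hg'g hgΩ) q w j κ‖ = 1 :=
  norm_weightAt_eq_one q (a 0) (a 2) (-1) w ha0 ha2 (neg_ne_zero.2 one_ne_zero) hw hcm j hκ

/-- `weightAt … j κ ≠ 0` on `T(𝔸)` of the seesaw plane. -/
theorem weightAt_ne_zero_seesaw (ha0 : a 0 ≠ 0) (ha2 : a 2 ≠ 0) (w : InfinitePlace k) (hw : w.IsReal)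
    (hcm : IsCMAt q w) (j : Fin 2) {κ : GA ((PlaneData.mixedRow q (a 0) (a 2)).withTransportedTorus g g' hgg' hg'g hgΩ)}
    (hκ : κ ∈ torusT ((PlaneData.mixedRow q (a 0) (a 2)).withTransportedTorus g g' hgg' hg'g hgΩ)) :
    weightAt ((PlaneData.mixedRow q (a 0) (a 2)).withTransportedTorus g g' hgg' hg'g hgΩ) q w j κ ≠ 0 := by
  intro h
  have := norm_weightAt_eq_one_seesaw q a g g' hgg' hg'g hgΩ ha0 ha2 w hw hcm j hκ
  rw [h, norm_zero] at this
  exact zero_ne_one this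

/-- `T(𝔸)` of the seesaw plane is commutative (RowTorus `torusT_ofLinesRow_comm` read on the seesaw plane). -/
theorem torusT_seesaw_mul_comm (ha0 : a 0 ≠ 0) (ha2 : a 2 ≠ 0)
    (x y : torusT ((PlaneData.mixedRow q (a 0) (a 2)).withTransportedTorus g g' hgg' hg'g hgΩ)) : x * y = y * x :=
  Subtype.ext (torusT_ofLinesRow_comm q (a 0) (a 2) (-1) ha0 ha2 (neg_ne_zero.2 one_ne_zero) x.1 y.1 x.2 y.2)

/-- `T_∞` of the seesaw plane is compact (typer-2's TorusInfCompact read on the seesaw plane). -/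
theorem compactSpace_torusInf_seesaw_of_real_cm (ha0 : a 0 ≠ 0) (ha2 : a 2 ≠ 0) (hreal : ∀ w : InfinitePlace k, w.IsReal)
    (hcm : ∀ w, IsCMAt q w) :
    CompactSpace (torusInf ((PlaneData.mixedRow q (a 0) (a 2)).withTransportedTorus g g' hgg' hg'g hgΩ)) :=
  compactSpace_infinitePart_subgroupOf_torusT_ofLinesRow q (a 0) (a 2) (-1) ha0 ha2 (neg_ne_zero.2 one_ne_zero)
    hreal hcm

/-- The weight monomial at `w` is multiplicative on `T(𝔸)`. -/
theorem weight_monomial_mul_seesaw (ha0 : a 0 ≠ 0) (ha2 : a 2 ≠ 0) (w : InfinitePlace k) (hw : w.IsReal)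
    (hcm : IsCMAt q w) (ePlus eMinus : ℤ)
    (κ κ' : torusT ((PlaneData.mixedRow q (a 0) (a 2)).withTransportedTorus g g' hgg' hg'g hgΩ)) :
    weightAt ((PlaneData.mixedRow q (a 0) (a 2)).withTransportedTorus g g' hgg' hg'g hgΩ) q w 0 (κ * κ').1 ^ (-ePlus) *
        weightAt ((PlaneData.mixedRow q (a 0) (a 2)).withTransportedTorus g g' hgg' hg'g hgΩ) q w 1 (κ * κ').1 ^ (-eMinus) =
      (weightAt ((PlaneData.mixedRow q (a 0) (a 2)).withTransportedTorus g g' hgg' hg'g hgΩ) q w 0 κ.1 ^ (-ePlus) *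
          weightAt ((PlaneData.mixedRow q (a 0) (a 2)).withTransportedTorus g g' hgg' hg'g hgΩ) q w 1 κ.1 ^ (-eMinus)) *
        (weightAt ((PlaneData.mixedRow q (a 0) (a 2)).withTransportedTorus g g' hgg' hg'g hgΩ) q w 0 κ'.1 ^ (-ePlus) *
          weightAt ((PlaneData.mixedRow q (a 0) (a 2)).withTransportedTorus g g' hgg' hg'g hgΩ) q w 1 κ'.1 ^ (-eMinus)) := by
  rw [Subgroup.coe_mul, weightAt_mul_seesaw q a g g' hgg' hg'g hgΩ ha0 ha2 w hw hcm 0 κ.2 κ'.2,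
    weightAt_mul_seesaw q a g g' hgg' hg'g hgΩ ha0 ha2 w hw hcm 1 κ.2 κ'.2, mul_zpow, mul_zpow]
  ring

/-- The weight monomial at `w` has modulus one on `T(𝔸)`. -/
theorem norm_weight_monomial_seesaw (ha0 : a 0 ≠ 0) (ha2 : a 2 ≠ 0) (w : InfinitePlace k) (hw : w.IsReal)
    (hcm : IsCMAt q w) (ePlus eMinus : ℤ)
    (κ : torusT ((PlaneData.mixedRow q (a 0) (a 2)).withTransportedTorus g g' hgg' hg'g hgΩ)) :
    ‖weightAt ((PlaneData.mixedRow q (a 0) (a 2)).withTransportedTorus g g' hgg' hg'g hgΩ) q w 0 κ.1 ^ (-ePlus) *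
        weightAt ((PlaneData.mixedRow q (a 0) (a 2)).withTransportedTorus g g' hgg' hg'g hgΩ) q w 1 κ.1 ^ (-eMinus)‖ = 1 := by
  rw [norm_mul, norm_zpow, norm_zpow, norm_weightAt_eq_one_seesaw q a g g' hgg' hg'g hgΩ ha0 ha2 w hw hcm 0 κ.2,
    norm_weightAt_eq_one_seesaw q a g g' hgg' hg'g hgΩ ha0 ha2 w hw hcm 1 κ.2, _root_.one_zpow, _root_.one_zpow,
    mul_one]

/-- The weight monomial at `w` is continuous on `T(𝔸)`. -/
theorem continuous_weight_monomial_seesaw (ha0 : a 0 ≠ 0) (ha2 : a 2 ≠ 0) (w : InfinitePlace k) (hw : w.IsReal)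
    (hcm : IsCMAt q w) (ePlus eMinus : ℤ) :
    Continuous fun κ : torusT ((PlaneData.mixedRow q (a 0) (a 2)).withTransportedTorus g g' hgg' hg'g hgΩ) =>
      weightAt ((PlaneData.mixedRow q (a 0) (a 2)).withTransportedTorus g g' hgg' hg'g hgΩ) q w 0 κ.1 ^ (-ePlus) *
        weightAt ((PlaneData.mixedRow q (a 0) (a 2)).withTransportedTorus g g' hgg' hg'g hgΩ) q w 1 κ.1 ^ (-eMinus) := by
  refine Continuous.mul ?_ ?_
  · exact ((continuous_weightAt q w _ 0).comp continuous_subtype_val).zpow₀ _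
      (fun κ => Or.inl (weightAt_ne_zero_seesaw q a g g' hgg' hg'g hgΩ ha0 ha2 w hw hcm 0 κ.2))
  · exact ((continuous_weightAt q w _ 1).comp continuous_subtype_val).zpow₀ _
      (fun κ => Or.inl (weightAt_ne_zero_seesaw q a g g' hgg' hg'g hgΩ ha0 ha2 w hw hcm 1 κ.2))

/-- **The archimedean weight character of `T` on the seesaw plane with prescribed `K`-type integers.** -/
theorem exists_weight_character_seesaw (ha0 : a 0 ≠ 0) (ha2 : a 2 ≠ 0) (hreal : ∀ w : InfinitePlace k, w.IsReal)
    (hcm : ∀ w, IsCMAt q w) (eP eM : InfinitePlace k → ℤ) :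
    ∃ ψ : ContinuousMonoidHom (torusT ((PlaneData.mixedRow q (a 0) (a 2)).withTransportedTorus g g' hgg' hg'g hgΩ))
      Circle, ∀ κ : torusT ((PlaneData.mixedRow q (a 0) (a 2)).withTransportedTorus g g' hgg' hg'g hgΩ),
        ((ψ κ : Circle) : ℂ) = ∏ w : InfinitePlace k,
          (weightAt ((PlaneData.mixedRow q (a 0) (a 2)).withTransportedTorus g g' hgg' hg'g hgΩ) q w 0 κ.1 ^ (-(eP w)) *
            weightAt ((PlaneData.mixedRow q (a 0) (a 2)).withTransportedTorus g g' hgg' hg'g hgΩ) q w 1 κ.1 ^ (-(eM w))) := by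
  let F : torusT ((PlaneData.mixedRow q (a 0) (a 2)).withTransportedTorus g g' hgg' hg'g hgΩ) → ℂ := fun κ =>
    ∏ w : InfinitePlace k,
      (weightAt ((PlaneData.mixedRow q (a 0) (a 2)).withTransportedTorus g g' hgg' hg'g hgΩ) q w 0 κ.1 ^ (-(eP w)) *
        weightAt ((PlaneData.mixedRow q (a 0) (a 2)).withTransportedTorus g g' hgg' hg'g hgΩ) q w 1 κ.1 ^ (-(eM w)))
  have hF_norm : ∀ κ, ‖F κ‖ = 1 := by
    intro κ
    simp only [F, norm_prod]
    exact Finset.prod_eq_one fun w _ =>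
      norm_weight_monomial_seesaw q a g g' hgg' hg'g hgΩ ha0 ha2 w (hreal w) (hcm w) (eP w) (eM w) κ
  have hF_mem : ∀ κ, F κ ∈ Submonoid.unitSphere ℂ := fun κ => mem_sphere_zero_iff_norm.mpr (hF_norm κ)
  have hF_mul : ∀ κ κ', F (κ * κ') = F κ * F κ' := by
    intro κ κ'
    simp only [F]
    rw [← Finset.prod_mul_distrib]
    exact Finset.prod_congr rfl fun w _ =>
      weight_monomial_mul_seesaw q a g g' hgg' hg'g hgΩ ha0 ha2 w (hreal w) (hcm w) (eP w) (eM w) κ κ'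
  have hF_one : F 1 = 1 := by
    simp only [F, Subgroup.coe_one, weightAt_one, _root_.one_zpow, mul_one, Finset.prod_const_one]
  have hF_cont : Continuous F :=
    continuous_finsetProd _ fun w _ =>
      continuous_weight_monomial_seesaw q a g g' hgg' hg'g hgΩ ha0 ha2 w (hreal w) (hcm w) (eP w) (eM w)
  refine ⟨{ toFun := fun κ => ⟨F κ, hF_mem κ⟩
            map_one' := Subtype.ext hF_one
            map_mul' := fun κ κ' => Subtype.ext (hF_mul κ κ')
            continuous_toFun := Continuous.subtype_mk hF_cont _ }, fun κ => rfl⟩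

/-- **THE WALL'S `chi` WITH `_hchi` ON THE SEESAW PLANE, modulo the print**: for any integers `eP eM`, a
`chi : T(𝔸) → ℂ`, multiplicative, trivial on `T(k)`, continuous, of modulus one, with
`ChiMatchesAt … (eP w) (eM w) chi` at every infinite place — the wall's `chi`, `chi_mul`, `chi_rational`, `hc`, `hu`,
`_hchi`.  Inputs: the seesaw plane's data, `hA` (cocompactness of `T(k)`, TorusCocompactAniso), `[hcl]`/`hbot` (L4-p2's
TorusArchClosed by name at the call site), `hDE` = the print [DE14] Cor. 3.6.2 on the compact quotient `T(k)\T(𝔸)`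
(the `CommGroup` in its type is `torusT_seesaw_mul_comm`; the compactness of the quotient is
`compactSpace_quotient_of_cocompact`). -/
theorem exists_wall_character_ktypes_seesaw (ht : q.t = 0) (hn : ¬ IsSquare (-q.n)) (ha : ∀ i, a i ≠ 0)
    (lam : k) (hlam : lam ≠ 0)
    (hiso : g * (PlaneData.mixedRow q (a 1) (a 3)).B * gᵀ = lam • (PlaneData.mixedRow q (a 0) (a 2)).B)
    (hreal : ∀ w : InfinitePlace k, w.IsReal) (hcm : ∀ w, IsCMAt q w)
    (hA : IsAnisotropic ((PlaneData.mixedRow q (a 0) (a 2)).withTransportedTorus g g' hgg' hg'g hgΩ))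
    [hcl : IsClosed ((rationalOf ((PlaneData.mixedRow q (a 0) (a 2)).withTransportedTorus g g' hgg' hg'g hgΩ)
      (torusT ((PlaneData.mixedRow q (a 0) (a 2)).withTransportedTorus g g' hgg' hg'g hgΩ)) :
      Subgroup (torusT ((PlaneData.mixedRow q (a 0) (a 2)).withTransportedTorus g g' hgg' hg'g hgΩ))) :
      Set (torusT ((PlaneData.mixedRow q (a 0) (a 2)).withTransportedTorus g g' hgg' hg'g hgΩ)))]
    (hbot : rationalOf ((PlaneData.mixedRow q (a 0) (a 2)).withTransportedTorus g g' hgg' hg'g hgΩ)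
      (torusT ((PlaneData.mixedRow q (a 0) (a 2)).withTransportedTorus g g' hgg' hg'g hgΩ)) ⊓
      torusInf ((PlaneData.mixedRow q (a 0) (a 2)).withTransportedTorus g g' hgg' hg'g hgΩ) = ⊥)
    (hDE : letI : CommGroup (torusT ((PlaneData.mixedRow q (a 0) (a 2)).withTransportedTorus g g' hgg' hg'g hgΩ)) :=
        { (inferInstance : Group (torusT ((PlaneData.mixedRow q (a 0) (a 2)).withTransportedTorus g g' hgg' hg'g hgΩ)))
          with mul_comm := torusT_seesaw_mul_comm q a g g' hgg' hg'g hgΩ (ha 0) (ha 2) }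
      haveI : CompactSpace (torusT ((PlaneData.mixedRow q (a 0) (a 2)).withTransportedTorus g g' hgg' hg'g hgΩ) ⧸
          rationalOf ((PlaneData.mixedRow q (a 0) (a 2)).withTransportedTorus g g' hgg' hg'g hgΩ)
            (torusT ((PlaneData.mixedRow q (a 0) (a 2)).withTransportedTorus g g' hgg' hg'g hgΩ))) :=
        compactSpace_quotient_of_cocompact _ (cocompact_rationalOf_torusT_of_anisotropic _
          (isGenuineRow_seesawPlane q ht hn a (ha 0) (ha 2) g g' hgg' hg'g hgΩ lam hlam hiso) hA)
      DeitmarEchterhoff2014_Cor_3_6_2_restriction_surjective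
        (torusT ((PlaneData.mixedRow q (a 0) (a 2)).withTransportedTorus g g' hgg' hg'g hgΩ) ⧸
          rationalOf ((PlaneData.mixedRow q (a 0) (a 2)).withTransportedTorus g g' hgg' hg'g hgΩ)
            (torusT ((PlaneData.mixedRow q (a 0) (a 2)).withTransportedTorus g g' hgg' hg'g hgΩ))))
    (eP eM : InfinitePlace k → ℤ) :
    ∃ chi : torusT ((PlaneData.mixedRow q (a 0) (a 2)).withTransportedTorus g g' hgg' hg'g hgΩ) → ℂ,
      (∀ s t, chi (s * t) = chi s * chi t) ∧
      (∀ t ∈ rationalOf ((PlaneData.mixedRow q (a 0) (a 2)).withTransportedTorus g g' hgg' hg'g hgΩ)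
        (torusT ((PlaneData.mixedRow q (a 0) (a 2)).withTransportedTorus g g' hgg' hg'g hgΩ)), chi t = 1) ∧
      Continuous chi ∧ (∀ t, ‖chi t‖ = 1) ∧
      ∀ w : InfinitePlace k, ChiMatchesAt ((PlaneData.mixedRow q (a 0) (a 2)).withTransportedTorus g g' hgg' hg'g hgΩ)
        q w (eP w) (eM w) chi := by
  haveI : CompactSpace (torusInf ((PlaneData.mixedRow q (a 0) (a 2)).withTransportedTorus g g' hgg' hg'g hgΩ)) :=
    compactSpace_torusInf_seesaw_of_real_cm q a g g' hgg' hg'g hgΩ (ha 0) (ha 2) hreal hcm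
  obtain ⟨ψ, hψ⟩ := exists_weight_character_seesaw q a g g' hgg' hg'g hgΩ (ha 0) (ha 2) hreal hcm eP eM
  let ι : ContinuousMonoidHom (torusInf ((PlaneData.mixedRow q (a 0) (a 2)).withTransportedTorus g g' hgg' hg'g hgΩ))
      (torusT ((PlaneData.mixedRow q (a 0) (a 2)).withTransportedTorus g g' hgg' hg'g hgΩ)) :=
    { (torusInf ((PlaneData.mixedRow q (a 0) (a 2)).withTransportedTorus g g' hgg' hg'g hgΩ)).subtype with
      continuous_toFun := continuous_subtype_val }
  let ψ' : ContinuousMonoidHom (torusInf ((PlaneData.mixedRow q (a 0) (a 2)).withTransportedTorus g g' hgg' hg'g hgΩ))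
      Circle := ψ.comp ι
  obtain ⟨chi, hmul, hrat, hcont, hunit, hinf⟩ :=
    exists_torusT_character_complex_of_print ((PlaneData.mixedRow q (a 0) (a 2)).withTransportedTorus g g' hgg' hg'g hgΩ)
      (torusT_seesaw_mul_comm q a g g' hgg' hg'g hgΩ (ha 0) (ha 2))
      (cocompact_rationalOf_torusT_of_anisotropic _
        (isGenuineRow_seesawPlane q ht hn a (ha 0) (ha 2) g g' hgg' hg'g hgΩ lam hlam hiso) hA) hbot hDE ψ'
  refine ⟨chi, hmul, hrat, hcont, hunit, fun w κ hκ => ?_⟩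
  have hκinf : κ ∈ torusInf ((PlaneData.mixedRow q (a 0) (a 2)).withTransportedTorus g g' hgg' hg'g hgΩ) := by
    rw [torusInf, Subgroup.mem_subgroupOf]
    exact mem_infinitePart_of_mem_atPlace _ hκ.2
  have h1 : chi κ = ((ψ κ : Circle) : ℂ) := hinf ⟨κ, hκinf⟩
  rw [h1, hψ κ, prod_weight_monomial_of_mem_localTorusAt _ q eP eM w hκ]
  have hA0 : weightAt ((PlaneData.mixedRow q (a 0) (a 2)).withTransportedTorus g g' hgg' hg'g hgΩ) q w 0 κ.1 ^ (eP w) ≠ 0 :=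
    zpow_ne_zero _ (weightAt_ne_zero_seesaw q a g g' hgg' hg'g hgΩ (ha 0) (ha 2) w (hreal w) (hcm w) 0 κ.2)
  have hB0 : weightAt ((PlaneData.mixedRow q (a 0) (a 2)).withTransportedTorus g g' hgg' hg'g hgΩ) q w 1 κ.1 ^ (eM w) ≠ 0 :=
    zpow_ne_zero _ (weightAt_ne_zero_seesaw q a g g' hgg' hg'g hgΩ (ha 0) (ha 2) w (hreal w) (hcm w) 1 κ.2)
  rw [_root_.zpow_neg, _root_.zpow_neg]
  field_simp

end Seesaw

end Summit.Ventures.HodgeRepro.Tier4.Line4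

end
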